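import Mathlib
import HarnessLib

/-!
# `NoHeavyLowerTail` (crux stmt-CriticalPhenomena-4575), antithetic vdBHK programme: the NESTED-HALVES criterion (tool T12)

Support file (seat `prim-ineq-gen-7` gen 21; `--supports stmt-CriticalPhenomena-4575`).  Nothing is asserted about the crux; no `sorry`,
no definitions.  Memo: run/shared/lean/prim/prim-ineq-gen-7/FINDING-NESTED-g21.md §2.

SETTING (as in `…KnQuestion8AntitheticProduct`, `…AntitheticCover`, `…AntitheticPicture`).  A finite preordered type `Ω` with a weight
`μ ≥ 0` and a `μ`-preserving involution `ι` is *antipodal Kleitman* (AK) if `Σ_u μ u · f u · (g u − g (ι u)) ≥ 0` for all monotone `f, g`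
(for the statements MASTER⁺ / ULEX / RAA of the memos `ι` also reverses the order; that is not needed below).

**T12 (nested halves).**  Let `L ⊆ Ω` be a half: `Φ` maps `L` injectively onto the complement of `L`, preserves `μ`, and LIFTS: `x ≤ Φ x` on `L`;
let `Φ` be `ι`-symmetric on `L` (`Φ (ι (Φ x)) = ι x`), so that `τ := ι ∘ Φ` maps `L` to `L`.  Let `κ` label fibres of `L` (in applications
`κ (τ x) = κ x`), let `Φ` be monotone on each fibre, and let each fibre be AK for `τ` in the form `Σ_{fibre} μ a (b − b∘τ) ≥ 0` for all `a, b`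
monotone on the fibre.  THEN `Ω` is AK.  (Formally neither `ι ∘ ι = id` nor `μ ∘ ι = μ` is used — only `ι(Ω ∖ L) ⊆ L` and the symmetry.)
Proof (three lines): `Σ_Ω μ f (g − gι) = Σ_L μ [f (g − g∘τ) + f' (g' − g'∘τ)] + Σ_L μ (f' − f)·((g' − g)∘τ)` with `f' = f∘Φ`, `g' = g∘Φ`;
the first sum is ≥ 0 fibre by fibre (AK of the fibres, `f', g'` monotone on fibres), the second termwise (`f ≤ f'`, `g ≤ g'` by the lift).
Compared with T11 (`AntitheticPicture.ak_of_fibres`) the fibres need only be AK, not positively associated — the form needed for inductions in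
which the fibres are themselves rooted-colouring posets.  Special cases: T4 (comparable orbits: `Φ = ι`, point fibres), the product with a
2-chain (one fibre, `Φ = ` the rung), the pendant-sink flip of THEOREM A of FINDING-RAA-g20 (fibres = free cubes), and the three-line induction
`Δ_n(A,B) = Δ_{n-1}(A₀,B₀) + Δ_{n-1}(A₁,B₁) + |(A₁∖A₀) ∩ ι(B₁∖B₀)|` for the Boolean lattice.
* `AntitheticNested.ak_of_nestedHalves` — T12 as stated;
* `AntitheticNested.ak_of_nestedHalves_one` — the one-fibre case.
-/

namespace Summit.CriticalPhenomena.PercolationContinuityZ3.Theorems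

open Finset

namespace AntitheticNested

variable {Ω : Type*} [Fintype Ω] [DecidableEq Ω] [Preorder Ω] {K : Type*} [DecidableEq K]

/-- **T12, nested halves.**  `μ ≥ 0`; `ι` maps the complement of the half `L` into `L`; `L` is matched upward onto its complement by an injective,
`μ`-preserving, `ι`-symmetric lift `Φ` (`x ≤ Φ x`, `Φ (ι (Φ x)) = ι x` on `L`); `κ` a fibre label on `L` invariant under `τ = ι ∘ Φ`, with `Φ`
monotone on fibres, and every fibre AK for `τ` (for functions monotone on the fibre).  Then
`0 ≤ Σ_u μ u · f u · (g u − g (ι u))` for all monotone `f g`. [this work] -/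
theorem ak_of_nestedHalves (μ : Ω → ℝ) (hμ : ∀ u, 0 ≤ μ u) (ι : Ω → Ω)
    (L : Finset Ω) (hL : ∀ u, u ∉ L → ι u ∈ L)
    (Φ : Ω → Ω) (hΦout : ∀ x ∈ L, Φ x ∉ L) (hΦonto : ∀ u, u ∉ L → ∃ x ∈ L, Φ x = u) (hΦinj : Set.InjOn Φ ↑L)
    (hμΦ : ∀ x ∈ L, μ (Φ x) = μ x) (hle : ∀ x ∈ L, x ≤ Φ x) (hsym : ∀ x ∈ L, Φ (ι (Φ x)) = ι x)
    (κ : Ω → K)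
    (hΦmono : ∀ x ∈ L, ∀ y ∈ L, κ x = κ y → x ≤ y → Φ x ≤ Φ y)
    (hAK : ∀ k : K, ∀ a b : Ω → ℝ,
      (∀ x ∈ L, ∀ y ∈ L, κ x = k → κ y = k → x ≤ y → a x ≤ a y) →
      (∀ x ∈ L, ∀ y ∈ L, κ x = k → κ y = k → x ≤ y → b x ≤ b y) →
      0 ≤ ∑ x ∈ L.filter (fun x => κ x = k), μ x * (a x * (b x - b (ι (Φ x)))))
    (f g : Ω → ℝ) (hf : Monotone f) (hg : Monotone g) :
    0 ≤ ∑ u, μ u * (f u * (g u - g (ι u))) := by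
  classical
  -- the complement of L is the image of L under Φ
  have himg : L.image Φ = univ \ L := by
    ext u
    simp only [Finset.mem_image, Finset.mem_sdiff, Finset.mem_univ, true_and]
    constructor
    · rintro ⟨x, hx, rfl⟩
      exact hΦout x hx
    · intro hu
      obtain ⟨x, hx, hxu⟩ := hΦonto u hu
      exact ⟨x, hx, hxu⟩
  -- split the sum over L and its complement, and pull the complement back to L along Φ
  have hsplit : ∑ u, μ u * (f u * (g u - g (ι u)))
      = ∑ x ∈ L, μ x * (f x * (g x - g (ι x))) + ∑ u ∈ univ \ L, μ u * (f u * (g u - g (ι u))) := by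
    rw [← Finset.sum_union (Finset.disjoint_sdiff)]
    congr 1
    exact (Finset.union_sdiff_of_subset (Finset.subset_univ L)).symm
  have hpull : ∑ u ∈ univ \ L, μ u * (f u * (g u - g (ι u)))
      = ∑ x ∈ L, μ x * (f (Φ x) * (g (Φ x) - g (ι (Φ x)))) := by
    rw [← himg, Finset.sum_image (fun x hx y hy h => hΦinj hx hy h)]
    refine Finset.sum_congr rfl (fun x hx => ?_)
    rw [hμΦ x hx]
  -- τ = ι ∘ Φ maps L to L, and ι x = Φ (τ x)
  have hτL : ∀ x ∈ L, ι (Φ x) ∈ L := fun x hx => hL _ (hΦout x hx)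
  -- pointwise identity on L
  have hpt : ∀ x ∈ L,
      μ x * (f x * (g x - g (ι x))) + μ x * (f (Φ x) * (g (Φ x) - g (ι (Φ x))))
        = (μ x * (f x * (g x - g (ι (Φ x)))) + μ x * ((f ∘ Φ) x * ((g ∘ Φ) x - (g ∘ Φ) (ι (Φ x)))))
          + μ x * ((f (Φ x) - f x) * (g (Φ (ι (Φ x))) - g (ι (Φ x)))) := by
    intro x hx
    have h1 : g (ι x) = g (Φ (ι (Φ x))) := by rw [hsym x hx]
    simp only [Function.comp]
    rw [h1]
    ring
  rw [hsplit, hpull, ← Finset.sum_add_distrib, Finset.sum_congr rfl hpt, Finset.sum_add_distrib, Finset.sum_add_distrib]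
  -- three nonnegative pieces
  have hA : 0 ≤ ∑ x ∈ L, μ x * (f x * (g x - g (ι (Φ x)))) := by
    rw [← Finset.sum_fiberwise_of_maps_to (s := L) (t := L.image κ) (g := κ) (fun x hx => Finset.mem_image_of_mem κ hx)
      (fun x => μ x * (f x * (g x - g (ι (Φ x)))))]
    refine Finset.sum_nonneg (fun k _ => ?_)
    exact hAK k f g (fun x _ y _ _ _ hxy => hf hxy) (fun x _ y _ _ _ hxy => hg hxy)
  have hB : 0 ≤ ∑ x ∈ L, μ x * ((f ∘ Φ) x * ((g ∘ Φ) x - (g ∘ Φ) (ι (Φ x)))) := by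
    rw [← Finset.sum_fiberwise_of_maps_to (s := L) (t := L.image κ) (g := κ) (fun x hx => Finset.mem_image_of_mem κ hx)
      (fun x => μ x * ((f ∘ Φ) x * ((g ∘ Φ) x - (g ∘ Φ) (ι (Φ x)))))]
    refine Finset.sum_nonneg (fun k _ => ?_)
    refine hAK k (f ∘ Φ) (g ∘ Φ) ?_ ?_
    · intro x hx y hy hxk hyk hxy
      exact hf (hΦmono x hx y hy (hxk.trans hyk.symm) hxy)
    · intro x hx y hy hxk hyk hxy
      exact hg (hΦmono x hx y hy (hxk.trans hyk.symm) hxy)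
  have hC : 0 ≤ ∑ x ∈ L, μ x * ((f (Φ x) - f x) * (g (Φ (ι (Φ x))) - g (ι (Φ x)))) := by
    refine Finset.sum_nonneg (fun x hx => ?_)
    refine mul_nonneg (hμ x) (mul_nonneg ?_ ?_)
    · exact sub_nonneg.2 (hf (hle x hx))
    · exact sub_nonneg.2 (hg (hle _ (hτL x hx)))
  linarith

omit [DecidableEq K] in
/-- **T12, one fibre.**  As `ak_of_nestedHalves` with a single fibre: `Φ` monotone on `L` and `(L, ≤, ι ∘ Φ, μ)` AK give AK of `Ω`.
(E.g. `Ω = P × {0 < 1}` with `L = P × {0}` and `Φ` the rung.) [this work] -/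
theorem ak_of_nestedHalves_one (μ : Ω → ℝ) (hμ : ∀ u, 0 ≤ μ u) (ι : Ω → Ω)
    (L : Finset Ω) (hL : ∀ u, u ∉ L → ι u ∈ L)
    (Φ : Ω → Ω) (hΦout : ∀ x ∈ L, Φ x ∉ L) (hΦonto : ∀ u, u ∉ L → ∃ x ∈ L, Φ x = u) (hΦinj : Set.InjOn Φ ↑L)
    (hμΦ : ∀ x ∈ L, μ (Φ x) = μ x) (hle : ∀ x ∈ L, x ≤ Φ x) (hsym : ∀ x ∈ L, Φ (ι (Φ x)) = ι x)
    (hΦmono : ∀ x ∈ L, ∀ y ∈ L, x ≤ y → Φ x ≤ Φ y)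
    (hAK : ∀ a b : Ω → ℝ, (∀ x ∈ L, ∀ y ∈ L, x ≤ y → a x ≤ a y) → (∀ x ∈ L, ∀ y ∈ L, x ≤ y → b x ≤ b y) →
      0 ≤ ∑ x ∈ L, μ x * (a x * (b x - b (ι (Φ x)))))
    (f g : Ω → ℝ) (hf : Monotone f) (hg : Monotone g) :
    0 ≤ ∑ u, μ u * (f u * (g u - g (ι u))) := by
  classical
  refine ak_of_nestedHalves μ hμ ι L hL Φ hΦout hΦonto hΦinj hμΦ hle hsym (fun _ => (0 : ℕ))
    (fun x hx y hy _ hxy => hΦmono x hx y hy hxy) ?_ f g hf hg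
  intro k a b ha hb
  have hfilter : L.filter (fun x => (fun _ : Ω => (0 : ℕ)) x = k) = if (0 : ℕ) = k then L else ∅ := by
    ext x
    by_cases h : (0 : ℕ) = k <;> simp [h]
  by_cases h : (0 : ℕ) = k
  · rw [hfilter, if_pos h]
    exact hAK a b (fun x hx y hy hxy => ha x hx y hy h h hxy) (fun x hx y hy hxy => hb x hx y hy h h hxy)
  · rw [hfilter, if_neg h, Finset.sum_empty]

end AntitheticNested

end Summit.CriticalPhenomena.PercolationContinuityZ3.Theorems
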